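import Mathlib
import Literature.Analysis.Complex.CauchyPompeiu
import Literature.Analysis.Complex.DbarAlongCalculus
import Literature.Analysis.Complex.SimilarityRegularisation
import HarnessLib

/-!
# The `δ`-regularised rank-one coefficient of the vector-valued similarity principle

For a smooth `w : ℂ → F` with values in a complex inner product space the differential
inequality `‖∂̄w‖ ≤ K ‖w‖` is turned into the EQUATION `∂̄w = A w + (small)` with a smooth bounded
operator field, uniformly in the regularisation parameter `δ > 0`:

* `SimilarityVector.rankOne a v = (x ↦ ⟪a, x⟫ • v)`, a smooth function of `(a, v)`, of norm
  `≤ ‖a‖ ‖v‖`;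
* `SimilarityVector.regOp w δ z = (‖w z‖² + δ)⁻¹ • rankOne (w z) (∂̄w z)`: then
  `∂̄w z - regOp w δ z (w z) = (δ / (‖w z‖² + δ)) • ∂̄w z` (`dbar_sub_regOp_apply_self`), of norm
  `≤ K √δ / 2` wherever `‖∂̄w z‖ ≤ K ‖w z‖` (`norm_dbar_sub_regOp_apply_self_le`), while
  `‖regOp w δ z‖ ≤ K` there (`norm_regOp_le`), and `regOp w δ` is `C^∞` for `C^∞` `w`
  (`contDiff_regOp`).

This is the vector counterpart of the scalar coefficient `a_δ = (∂̄w) w̄ / (|w|² + δ)` of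
`Literature/Analysis/Complex/SimilarityRegularisation.lean` (there `F = ℂ`); the rank-one
operator `(∂̄w) ⊗ w† / (|w|² + δ)` is the standard device turning the inequality `|∂̄w| ≤ K|w|`
into a linear equation `∂̄w + A w = 0` with `A ∈ L^∞` (Wendl, *Lectures on holomorphic curves*,
proof of Prop. 2.54 from Thm 2.50; McDuff–Salamon (2012), §2.3), regularised so that classical
calculus applies. Everything is proved.

## References

* C. Wendl, *Lectures on Holomorphic Curves in Symplectic and Contact Geometry*
  (arXiv:1011.1690), Thm 2.50, Prop. 2.54. [WendlLectures2010]
* D. McDuff, D. Salamon, *J-holomorphic curves and symplectic topology*, 2nd ed. (2012), §2.3.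
  [McDuffSalamon2012]
-/

noncomputable section

open scoped ContDiff Topology Real InnerProductSpace
open Set Metric Filter Complex

namespace Literature.Analysis.Complex

namespace SimilarityVector

variable {F : Type*} [NormedAddCommGroup F] [InnerProductSpace ℂ F]

/-! ### The rank-one operators `x ↦ ⟪a, x⟫ • v` -/

/-- The bra map `a ↦ ⟪a, ·⟫` as a REAL continuous linear map into the complex dual (it is
conjugate-linear over `ℂ`). [folklore] -/
def braReal (F : Type*) [NormedAddCommGroup F] [InnerProductSpace ℂ F] :
    F →L[ℝ] (F →L[ℂ] ℂ) where
  toFun a := innerSL ℂ a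
  map_add' a b := map_add _ a b
  map_smul' r a := by
    ext x
    show ⟪r • a, x⟫_ℂ = r • ⟪a, x⟫_ℂ
    rw [RCLike.real_smul_eq_coe_smul (K := ℂ) r a, inner_smul_real_left]
  cont := (innerSL ℂ).continuous

/-- Unfolding `braReal`. [folklore] -/
@[simp] theorem braReal_apply (a x : F) : braReal F a x = ⟪a, x⟫_ℂ := rfl

/-- The **rank-one operator** `x ↦ ⟪a, x⟫ • v`. [folklore] -/
def rankOne (a v : F) : F →L[ℂ] F := (innerSL ℂ a).smulRight v

/-- Unfolding `rankOne`. [folklore] -/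
@[simp] theorem rankOne_apply (a v x : F) : rankOne a v x = ⟪a, x⟫_ℂ • v := rfl

/-- `rankOne a v a = ‖a‖² • v`. [folklore] -/
theorem rankOne_apply_self (a v : F) : rankOne a v a = (‖a‖ ^ 2 : ℝ) • v := by
  rw [rankOne_apply, inner_self_eq_norm_sq_to_K, RCLike.real_smul_eq_coe_smul (K := ℂ)]
  norm_cast

/-- `‖rankOne a v‖ ≤ ‖a‖ ‖v‖`. [folklore] -/
theorem norm_rankOne_le (a v : F) : ‖rankOne a v‖ ≤ ‖a‖ * ‖v‖ := by
  rw [rankOne, ContinuousLinearMap.norm_smulRight_apply, innerSL_apply_norm]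

/-- `(a, v) ↦ rankOne a v` is `C^∞` (over `ℝ`): a bounded `ℂ`-bilinear map of
`(⟪a, ·⟫, v)`, and `a ↦ ⟪a, ·⟫` is real-linear continuous. [folklore] -/
theorem contDiff_rankOne {n : WithTop ℕ∞} : ContDiff ℝ n fun p : F × F => rankOne p.1 p.2 := by
  have h1 : ContDiff ℝ n fun q : (F →L[ℂ] ℂ) × F => q.1.smulRight q.2 :=
    ((isBoundedBilinearMap_smulRight (𝕜 := ℂ) (E := F) (F := F)).contDiff).restrict_scalars ℝ
  have h2 : ContDiff ℝ n fun p : F × F => (braReal F p.1, p.2) :=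
    ((braReal F).contDiff.comp contDiff_fst).prodMk contDiff_snd
  exact h1.comp h2

/-- `z ↦ rankOne (a z) (v z)` is `Cⁿ` when `a`, `v` are. [folklore] -/
theorem contDiff_rankOne_comp {a v : ℂ → F} {n : WithTop ℕ∞} (ha : ContDiff ℝ n a)
    (hv : ContDiff ℝ n v) : ContDiff ℝ n fun z => rankOne (a z) (v z) :=
  contDiff_rankOne.comp (ha.prodMk hv)

/-! ### The regularised operator field -/

/-- The **`δ`-regularised coefficient** `regOp w δ z = (‖w z‖² + δ)⁻¹ • ((∂̄w z) ⊗ (w z)†)`,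
i.e. `x ↦ ⟪w z, x⟫ / (‖w z‖² + δ) • ∂̄w z`. [cite: WendlLectures2010, Prop. 2.54 (proof)] -/
def regOp (w : ℂ → F) (δ : ℝ) (z : ℂ) : F →L[ℂ] F :=
  ((‖w z‖ ^ 2 + δ)⁻¹ : ℝ) • rankOne (w z) (dbarAlong 1 w z)

/-- Unfolding `regOp`. [folklore] -/
theorem regOp_apply (w : ℂ → F) (δ : ℝ) (z : ℂ) (x : F) :
    regOp w δ z x = ((‖w z‖ ^ 2 + δ)⁻¹ : ℝ) • (⟪w z, x⟫_ℂ • dbarAlong 1 w z) := by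
  simp [regOp]

/-- `regOp w δ z (w z) = (‖w z‖² / (‖w z‖² + δ)) • ∂̄w z`. [folklore] -/
theorem regOp_apply_self (w : ℂ → F) (δ : ℝ) (z : ℂ) :
    regOp w δ z (w z) = ((‖w z‖ ^ 2 + δ)⁻¹ * ‖w z‖ ^ 2 : ℝ) • dbarAlong 1 w z := by
  show ((‖w z‖ ^ 2 + δ)⁻¹ : ℝ) • rankOne (w z) (dbarAlong 1 w z) (w z) = _
  rw [rankOne_apply_self, smul_smul]

/-- **The key identity**: `∂̄w z - regOp w δ z (w z) = (δ / (‖w z‖² + δ)) • ∂̄w z`. [folklore] -/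
theorem dbar_sub_regOp_apply_self (w : ℂ → F) {δ : ℝ} (hδ : 0 < δ) (z : ℂ) :
    dbarAlong 1 w z - regOp w δ z (w z) = (δ / (‖w z‖ ^ 2 + δ) : ℝ) • dbarAlong 1 w z := by
  have hN : (‖w z‖ ^ 2 + δ) ≠ 0 := by positivity
  rw [regOp_apply_self]
  have : (δ / (‖w z‖ ^ 2 + δ) : ℝ) = 1 - (‖w z‖ ^ 2 + δ)⁻¹ * ‖w z‖ ^ 2 := by
    field_simp
    ring
  rw [this, sub_smul, one_smul]

/-- **The defect bound**: if `‖∂̄w z‖ ≤ K ‖w z‖` then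
`‖∂̄w z - regOp w δ z (w z)‖ ≤ K √δ / 2`. [folklore] -/
theorem norm_dbar_sub_regOp_apply_self_le (w : ℂ → F) {δ K : ℝ} (hδ : 0 < δ) (hK : 0 ≤ K)
    {z : ℂ} (hz : ‖dbarAlong 1 w z‖ ≤ K * ‖w z‖) :
    ‖dbarAlong 1 w z - regOp w δ z (w z)‖ ≤ K * Real.sqrt δ / 2 := by
  have hN : 0 < ‖w z‖ ^ 2 + δ := by positivity
  rw [dbar_sub_regOp_apply_self w hδ z, norm_smul, Real.norm_of_nonneg (by positivity),
    div_mul_eq_mul_div, div_le_iff₀ hN]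
  calc δ * ‖dbarAlong 1 w z‖ ≤ δ * (K * ‖w z‖) := by gcongr
    _ = K * (‖w z‖ * δ) := by ring
    _ ≤ K * (Real.sqrt δ / 2 * (‖w z‖ ^ 2 + δ)) :=
        mul_le_mul_of_nonneg_left (Similarity.mul_le_sqrt_half_mul ‖w z‖ δ (norm_nonneg _) hδ) hK
    _ = K * Real.sqrt δ / 2 * (‖w z‖ ^ 2 + δ) := by ring

/-- **The uniform bound**: if `‖∂̄w z‖ ≤ K ‖w z‖` then `‖regOp w δ z‖ ≤ K`, uniformly in
`δ > 0`. [folklore] -/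
theorem norm_regOp_le (w : ℂ → F) {δ K : ℝ} (hδ : 0 < δ) (hK : 0 ≤ K) {z : ℂ}
    (hz : ‖dbarAlong 1 w z‖ ≤ K * ‖w z‖) : ‖regOp w δ z‖ ≤ K := by
  have hN : 0 < ‖w z‖ ^ 2 + δ := by positivity
  rw [regOp, norm_smul, Real.norm_of_nonneg (by positivity)]
  calc (‖w z‖ ^ 2 + δ)⁻¹ * ‖rankOne (w z) (dbarAlong 1 w z)‖
      ≤ (‖w z‖ ^ 2 + δ)⁻¹ * (‖w z‖ * (K * ‖w z‖)) := by
        gcongr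
        exact (norm_rankOne_le _ _).trans (by gcongr)
    _ = K * (‖w z‖ ^ 2 / (‖w z‖ ^ 2 + δ)) := by ring
    _ ≤ K * 1 := by
        gcongr
        rw [div_le_one hN]
        linarith
    _ = K := mul_one K

/-- **Smoothness**: `regOp w δ` is `C^∞` for `C^∞` `w` and `δ > 0`. [folklore] -/
theorem contDiff_regOp {w : ℂ → F} (hw : ContDiff ℝ ∞ w) {δ : ℝ} (hδ : 0 < δ) :
    ContDiff ℝ ∞ (regOp w δ) := by
  have h1 : ContDiff ℝ ∞ fun z => ((‖w z‖ ^ 2 + δ)⁻¹ : ℝ) := by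
    refine ContDiff.inv ?_ fun z => (by positivity : (‖w z‖ ^ 2 + δ) ≠ 0)
    exact ((contDiff_norm_sq ℂ).comp hw).add contDiff_const
  have h2 : ContDiff ℝ ∞ fun z => rankOne (w z) (dbarAlong 1 w z) :=
    contDiff_rankOne_comp hw (contDiff_infty_dbarAlong hw 1)
  exact h1.smul h2

/-- Continuity of `regOp w δ` for `C^∞` `w`. [folklore] -/
theorem continuous_regOp {w : ℂ → F} (hw : ContDiff ℝ ∞ w) {δ : ℝ} (hδ : 0 < δ) :
    Continuous (regOp w δ) :=
  (contDiff_regOp hw hδ).continuous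

/-! ### The cut-off coefficient `B = χ • regOp w δ` -/

/-- **The cut-off coefficient, packaged.** Let `w` be `C^∞` with `‖∂̄w z‖ ≤ K ‖w z‖` for
`‖z‖ < ρ`, and let `χ : ℂ → ℂ` be `C^∞` with `‖χ‖ ≤ 1` and `χ z ≠ 0 → ‖z‖ < ρ`. Then
`B := χ • regOp w δ` is `C^∞`, supported in `‖z‖ < ρ`, bounded by `K`, and wherever `χ z = 1`
the defect `∂̄w z - B z (w z)` has norm `≤ K √δ / 2`. [folklore] -/
theorem cutoffCoefficient {w : ℂ → F} (hw : ContDiff ℝ ∞ w) {δ K ρ : ℝ} (hδ : 0 < δ)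
    (hK : 0 ≤ K) (hineq : ∀ z, ‖z‖ < ρ → ‖dbarAlong 1 w z‖ ≤ K * ‖w z‖)
    {χ : ℂ → ℂ} (hχ : ContDiff ℝ ∞ χ) (hχρ : ∀ z, χ z ≠ 0 → ‖z‖ < ρ) (hχ1 : ∀ z, ‖χ z‖ ≤ 1) :
    ContDiff ℝ ∞ (fun z => χ z • regOp w δ z) ∧
      (∀ z, χ z • regOp w δ z ≠ 0 → ‖z‖ < ρ) ∧
      (∀ z, ‖χ z • regOp w δ z‖ ≤ K) ∧
      ∀ z, χ z = 1 → ‖dbarAlong 1 w z - (χ z • regOp w δ z) (w z)‖ ≤ K * Real.sqrt δ / 2 := by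
  refine ⟨hχ.smul (contDiff_regOp hw hδ), fun z hz => hχρ z fun h => hz (by rw [h, zero_smul]),
    fun z => ?_, fun z hz1 => ?_⟩
  · by_cases hχz : χ z = 0
    · rw [hχz, zero_smul, norm_zero]; exact hK
    · rw [norm_smul]
      calc ‖χ z‖ * ‖regOp w δ z‖ ≤ 1 * K := by
            gcongr
            · exact hχ1 z
            · exact norm_regOp_le w hδ hK (hineq z (hχρ z hχz))
        _ = K := one_mul K
  · rw [hz1, one_smul]
    have hzρ : ‖z‖ < ρ := hχρ z (by rw [hz1]; exact one_ne_zero)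
    exact norm_dbar_sub_regOp_apply_self_le w hδ hK (hineq z hzρ)

end SimilarityVector

end Literature.Analysis.Complex
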